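import Literature.AnabelianGeometry.EtaleTheta.TemperedFrobenioidOfGenDiagonalBase
import Literature.AnabelianGeometry.EtaleTheta.LogDivisorModelTateTowerThetaCoordinates
import Literature.AnabelianGeometry.EtaleTheta.TemperedFrobenioidOfGaloisCoveringZTower
import HarnessLib

/-!
# [EtTh] Def. 3.6 (ii) / Def. 4.1: the tempered Frobenioid of the `Ÿ`-SKELETON WITH CUSPS AND THETA over the genuine connected base
# `B^temp(Π^tp_X)⁰` — `Φ^{bs-fld} ⊊ Φ` at EVERY covering, the §4 bi-Kummer setting over it (Tate tower v3 — class (b) NV)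

S. Mochizuki, *The étale theta function …*, Publ. RIMS **45** (2009) [MochizukiEtTh2009], Def. 3.3 (iii) / Rmk. 3.3.1 p.73, Def. 3.6 (ii)
p.76–77 (`Φ^{bs-fld} := Φ ∩ ℝ·Φ₀^cnst` monoprime), Def. 4.1 p.86, Prop. 1.4 (i) p.21 [cite: MochizukiEtTh2009, Def 3.6 p.77]; [FrdI]
Thm. 5.2 (ii) p.100; [FrdII] Ex. 1.3 p.11.

abc-iut cell, layer L2 [EtTh]; seat abc-iut-L2-t3 (gen 7), row R822 «DIAGONALBASE′ + TF OVER TATETOWERTHETA» (abc-iut-L2-lead gen 6),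
file B.  Consumed BY NAME: this seat's engine variant `TemperedFrobenioid.ofGenDiagonalBase` (file A) and `Ÿ`-skeleton
`TateTowerTheta.model / action φ / coord / diag / thetaZerosPhi / cnstFn` (p476816 / p477445 / p478021); abc-iut-w6-d048's small model
`DivisorMonoids.ofGaloisActionCosetCat` over `CosetCat Π^tp_X ≌ B^temp(Π^tp_X)⁰` (`OneCompTempered.equiv`); abc-iut-L2-t4's
`BiKummerSetting.mkOfConnectedTemperoid`.  The EXACT analogue of abc-iut-w5-d179's ℤ-tower `ZTowerTempered` (p463800) with the
chain-only skeleton replaced by the `Ÿ`-skeleton: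
* `ThetaTowerTempered.dm X φ` — Def. 3.3 (iii) data over `CosetCat Π^tp_X` for EVERY tempered `X` and character `φ : Π^tp_X → ℤ`:
  at `Π/H`, `Φ₀(Π/H) = Hom_Π(Π/H, Div⁺(Ÿ-skeleton))` = equivariant effective divisors on cusps ⊔ components;
* `ThetaTowerTempered.genDiagonalBase X φ` — file A's PATTERN data: coordinates `TateTowerTheta.coord (s, x)` for EVERY prime log-divisor
  `x ∈ Cusp ⊔ Comp`, diagonal `diag = div ϖ̈` (pattern `1` on components, `0` at cusps), `Φ₀^cnst = ⟨[diag]⟩`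
  (`divZeroHom_mem_zpowers_of_mem_fZero`), pull-backs injective / reflecting;
* **`ThetaTowerTempered.temperedFrobenioid X φ R S`** — Def. 3.6 (ii) data of monoid type `ℤ` over `B^temp(Π^tp_X)⁰`, EVERY clause
  proved; it IS a Frobenioid; `baseShape`, `hBD`, `hP`; and **`exists_mem_Φ_not_mem_bsFld` — `Φ^{bs-fld}(A) ⊊ Φ(A)` at EVERY covering
  `A`** (the class of the zero divisor of `Θ̈`, all cusps, is in `Φ` but is no root of a power of the diagonal:
  `thetaZerosPhi_pow_ne_diag_pow`) — the first tempered Frobenioid of record at which Def. 3.6 (ii)(a) has content at the one-point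
  covering too (the chain-only models are rank one there);
* `ThetaTowerTempered.setting` — the §4 bi-Kummer setting over these data at `A_⊙ := (Π^tp_X/M, 0)` (`nonempty_setting`).
The coprimality-pull-back law (`CoprimePullLaw`) for this tf is file C.  Class (b): 3 defs (`genDiagonalBase`, `temperedFrobenioid`,
`setting`) + 2 abbrevs (`dm`, `gset`); no Prop-valued fact, no instance, no notation, no sorry.  HONEST FRAMING: class (b) construction
at a combinatorial skeleton (NOT the formal scheme `Ÿ`); nothing here bears on [IUTchIII] Cor. 3.12; no side taken; typed ≠ proved.
-/

noncomputable section

namespace Literature.AnabelianGeometry.EtaleTheta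

open CategoryTheory Opposite Function Literature.AlgebraicGeometry.Frobenioids
  Literature.AnabelianGeometry.SemiGraphs LogDivisorModel LogDivisorModel.GaloisAction

namespace ThetaTowerTempered

variable {K : Type} [Field K] (X : SemiGraphs.TemperedArithmeticGroup.{0} K) (φ : X.Pi →* Multiplicative ℤ)

/-- **The Def. 3.3 (iii) data of the `Ÿ`-skeleton**: `Π^tp_X` translating cusps and components through `φ`, over the small model
`CosetCat Π^tp_X` of `B^temp(Π^tp_X)⁰`. [cite: MochizukiEtTh2009, Def 3.3 p.73] -/
abbrev dm : DivisorMonoids.{0, 0, 0} (CosetCat X.Pi) :=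
  DivisorMonoids.ofGaloisActionCosetCat X.isTempered (TateTowerTheta.action φ) TateTowerTheta.cuspLaws

/-- Prop. 3.4 (i) (weak, cofinal perfection) at every `Φ₀(Π/H)` — the `hpf` slot (abc-iut-w6-d057's generic theorem).
[cite: MochizukiEtTh2009, Prop 3.4 p.74] -/
theorem hpf : ∀ Y : (CosetCat X.Pi)ᵒᵖ, IsPerfFactorialCof ((dm X φ).Φ₀.obj Y) :=
  fun Y => DivisorMonoids.ofGaloisActionCosetCat_isPerfFactorialCof X.isTempered _ _ Y

/-- The `Π^tp_X`-set underlying a connected tempered covering (through `B^temp(Π)⁰ ⥤ CosetCat Π`). [cite: MochizukiFrdII2008, Ex 1.3 (i) p.11] -/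
abbrev gset (A : ConnectedPart (BTemp X.Pi)) : Action (Type 0) X.Pi :=
  ((CosetCat.toBTemp X.isTempered).obj ((OneCompTempered.equiv X).inverse.obj A)).obj

/-- `gset A` is connected (one orbit, nonempty). [cite: MochizukiFrdII2008, Ex 1.3 (ii) p.11] -/
theorem isConnectedGSet_gset (A : ConnectedPart (BTemp X.Pi)) : isConnectedGSet (gset X A) :=
  OneCompTempered.isConnectedGSet_toBTemp X _

/-- `gset A` is nonempty. [cite: MochizukiFrdII2008, Ex 1.3 (ii) p.11] -/
theorem nonempty_gset (A : ConnectedPart (BTemp X.Pi)) : Nonempty (gset X A).V := (isConnectedGSet_gset X A).1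

/-- **Pattern diagonal base data of the `Ÿ`-skeleton along `B^temp(Π^tp_X)⁰ ⥤ CosetCat Π^tp_X`**: coordinates = multiplicities at
EVERY prime log-divisor `(s, x)`, `x ∈ Cusp ⊔ Comp`; diagonal = `div ϖ̈` (coordinate `1` on the components, `0` at the cusps);
`Φ₀^cnst = ⟨[diag]⟩`. [cite: MochizukiEtTh2009, Def 3.6 p.77] -/
def genDiagonalBase : TemperedFrobenioid.GenDiagonalBase (dm X φ) (ConnectedPart (BTemp X.Pi)) where
  F := (OneCompTempered.equiv X).inverse
  I A := (gset X A).V × TateTowerTheta.Idx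
  i₀ A := ((isConnectedGSet_gset X A).1.some, Sum.inr 0)
  κ A i := TateTowerTheta.coord φ (gset X A) i.1 i.2
  d A := TateTowerTheta.diag φ (gset X A)
  κ_d₀ A := TateTowerTheta.coord_diag φ (gset X A) _ _
  eq_pow_of_κ_eq A _ c h := TateTowerTheta.coord_separating φ (gset X A) fun s x =>
    (h (s, x)).trans (map_pow (TateTowerTheta.coord φ (gset X A) s x) _ c).symm
  div₀_mem_zpowers A _ hb := TateTowerTheta.divZeroHom_mem_zpowers_of_mem_fZero φ (isConnectedGSet_gset X A) hb
  exists_div₀_eq A := ⟨TateTowerTheta.cnstFn φ (gset X A) TateTowerTheta.unif ⟨rfl, rfl⟩,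
    TateTowerTheta.cnstFn_mem_fZero φ _ _ _, TateTowerTheta.divZeroHom_cnstFn_unif φ⟩
  hΦinj _ := DivisorMonoids.ofGaloisActionCosetCat_Φ₀_map_injective X.isTempered _ _ _
  hΦrefl _ a b h := DivisorMonoids.ofGaloisActionCosetCat_Φ₀_map_reflects_dvd X.isTempered _ _ _ a b h

/-- The base functor of the data is the equivalence inverse. [cite: MochizukiEtTh2009, Def 3.6 p.77] -/
@[simp] theorem genDiagonalBase_F : (genDiagonalBase X φ).F = (OneCompTempered.equiv X).inverse := rfl

/-- The diagonal of the data at `A` is `TateTowerTheta.diag`. [cite: MochizukiEtTh2009, Def 3.6 p.77] -/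
@[simp] theorem genDiagonalBase_d (A : ConnectedPart (BTemp X.Pi)) :
    (genDiagonalBase X φ).d A = TateTowerTheta.diag φ (gset X A) := rfl

variable (R S : ((ConnectedPart (BTemp X.Pi))ᵒᵖ ⥤ CommMonCat.{0}) → Prop)

/-- **The tempered Frobenioid of the `Ÿ`-skeleton over the GENUINE base `B^temp(Π^tp_X)⁰`** (file A's engine along the pattern data):
monoid type `ℤ`, `Φ := im(Φ₀^pf → Φ₀^rlf)`, every Def. 3.6 (ii) clause proved. [cite: MochizukiEtTh2009, Def 3.6 p.77] -/
def temperedFrobenioid :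
    TemperedFrobenioid (RealifiedDivisorMonoids.ofRlfZWeak (dm X φ) (hpf X φ)) (ConnectedPart (BTemp X.Pi))
      (treeCatVocab (ConnectedPart (BTemp X.Pi)) R S) :=
  TemperedFrobenioid.ofGenDiagonalBase (hpf X φ) (genDiagonalBase X φ) QuasiTemperoid.BTempConnected.connectedPart_isConnected
    QuasiTemperoid.BTempConnected.connectedPart_isTotallyEpimorphic QuasiTemperoid.BTempConnected.connectedPart_isOfFSMType R S

/-- Its base functor IS the equivalence inverse `B^temp(Π^tp_X)⁰ ⥤ CosetCat Π^tp_X`. [cite: MochizukiEtTh2009, Def 3.6 p.77] -/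
theorem temperedFrobenioid_base : (temperedFrobenioid X φ R S).base = (OneCompTempered.equiv X).inverse := rfl

/-- `Φ(A) = im(Φ₀(Π/H)^pf → Φ₀(Π/H)^rlf)`. [cite: MochizukiEtTh2009, Def 3.6 p.77] -/
theorem temperedFrobenioid_Φ_carrier (A : (ConnectedPart (BTemp X.Pi))ᵒᵖ) :
    (temperedFrobenioid X φ R S).Φ.carrier A = (genDiagonalBase X φ).pfImage (hpf X φ) A := rfl

/-- **Def. 3.6 (ii)(a) WITH CONTENT: `Φ^{bs-fld}(A) = ι(⟨diag⟩^pf)`** (the roots of the powers of the reduced special fibre).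
[cite: MochizukiEtTh2009, Def 3.6 p.77] -/
theorem temperedFrobenioid_bsFld_carrier (A : (ConnectedPart (BTemp X.Pi))ᵒᵖ) :
    (temperedFrobenioid X φ R S).bsFld.carrier A = (genDiagonalBase X φ).diagImage (hpf X φ) A :=
  TemperedFrobenioid.ofGenDiagonalBase_bsFld_carrier (hpf X φ) (genDiagonalBase X φ) _ _ _ R S A

/-- The base functor is full. [cite: MochizukiEtTh2009, Def 4.1 p.86] -/
theorem temperedFrobenioid_base_full : (temperedFrobenioid X φ R S).base.Full := by
  rw [temperedFrobenioid_base]; infer_instance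

/-- The base functor is faithful. [cite: MochizukiEtTh2009, Def 4.1 p.86] -/
theorem temperedFrobenioid_base_faithful : (temperedFrobenioid X φ R S).base.Faithful := by
  rw [temperedFrobenioid_base]; infer_instance

/-- **`baseShape`**: `D = D₀[𝒟]` with `𝒟 := Π^tp_X/Π^tp_X`. [cite: MochizukiEtTh2009, Def 4.1 p.86] -/
theorem baseShape : (temperedFrobenioid X φ R S).base.Full ∧ (temperedFrobenioid X φ R S).base.Faithful ∧
    ∃ 𝒟 : CosetCat X.Pi, ∀ Y : CosetCat X.Pi,
      (∃ A : ConnectedPart (BTemp X.Pi), Nonempty ((temperedFrobenioid X φ R S).base.obj A ≅ Y)) ↔ Nonempty (Y ⟶ 𝒟) :=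
  ⟨temperedFrobenioid_base_full X φ R S, temperedFrobenioid_base_faithful X φ R S, CosetCat.top, fun Y =>
    ⟨fun _ => ⟨CosetCat.toTop Y⟩, fun _ =>
      ⟨(OneCompTempered.equiv X).functor.obj Y, ⟨((OneCompTempered.equiv X).unitIso.app Y).symm⟩⟩⟩⟩

/-- `hBD`: the `B₀`-pull-backs along base images are injective. [cite: MochizukiEtTh2009, Def 3.6 p.76] -/
theorem hBD {A B : ConnectedPart (BTemp X.Pi)} (α : B ⟶ A) :
    Injective ((RealifiedDivisorMonoids.ofRlfZWeak (dm X φ) (hpf X φ)).BΛ.map ((temperedFrobenioid X φ R S).base.map α).op).hom :=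
  DivisorMonoids.ofGaloisActionCosetCat_B₀_map_injective X.isTempered _ _ _

/-- **The `Ÿ`-skeleton model IS a Frobenioid** ([FrdI] Thm. 5.2 (ii)). [cite: MochizukiFrdI2008, Thm. 5.2 (ii) p.100] -/
theorem isFrobenioid_temperedFrobenioid : PreFrobenioid.IsFrobenioid (temperedFrobenioid X φ R S).toElem :=
  TemperedFrobenioid.isFrobenioid_ofGenDiagonalBase (hpf X φ) (genDiagonalBase X φ) _ _ _ R S
    fun g => DivisorMonoids.ofGaloisActionCosetCat_B₀_map_injective X.isTempered _ _ g

/-- `Φ(A)` is perfect — the `hP` slot. [cite: MochizukiEtTh2009, Def 4.1 p.86] -/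
theorem hP (A : (ConnectedPart (BTemp X.Pi))ᵒᵖ) : IsPerfect ((temperedFrobenioid X φ R S).Φ.carrier A) :=
  TemperedFrobenioid.ofGenDiagonalBase_isPerfect (hpf X φ) (genDiagonalBase X φ) _ _ _ R S A

/-! ## `Φ^{bs-fld} ⊊ Φ` at EVERY covering: the class of the zero divisor of `Θ̈` -/

/-- The class `ι((div₊ Θ̈)^{1/1}) ∈ Φ(A)` of the zero divisor of `Θ̈` (all cusps of the covering, multiplicity `1`).
[cite: MochizukiEtTh2009, Prop 1.4 p.21] -/
theorem thetaZeros_mem_Φ (A : ConnectedPart (BTemp X.Pi)) :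
    (hpf X φ (op ((OneCompTempered.equiv X).inverse.obj A))).weak.toRealification
        (Perfection.of _ (TateTowerTheta.thetaZerosPhi φ (gset X A))) ∈
      (temperedFrobenioid X φ R S).Φ.carrier (op A) :=
  ⟨_, rfl⟩

/-- **`Φ^{bs-fld}(A) ⊊ Φ(A)` at EVERY connected tempered covering `A`**: the class of the zero divisor of `Θ̈` lies in `Φ(A)` but not in
`ι(⟨diag⟩^pf) = Φ^{bs-fld}(A)` (no positive power of it is a power of the diagonal: cusps vs components).  At the chain-only models
this failed at the one-point covering (`Φ₀(Γ/Γ) ≅ ℤ_{≥0}`). [cite: MochizukiEtTh2009, Def 3.6 p.77] -/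
theorem exists_mem_Φ_not_mem_bsFld (A : ConnectedPart (BTemp X.Pi)) :
    ∃ x ∈ (temperedFrobenioid X φ R S).Φ.carrier (op A), x ∉ (temperedFrobenioid X φ R S).bsFld.carrier (op A) := by
  haveI := nonempty_gset X A
  have hM := hpf X φ (op ((OneCompTempered.equiv X).inverse.obj A))
  refine ⟨hM.weak.toRealification (Perfection.of _ (TateTowerTheta.thetaZerosPhi φ (gset X A))), thetaZeros_mem_Φ X φ R S A, ?_⟩
  rw [temperedFrobenioid_bsFld_carrier]
  rintro ⟨b, hb⟩
  obtain ⟨⟨c, n⟩, rfl⟩ := Perfection.mk_surjective b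
  have h1 : Perfection.mk (TateTowerTheta.diag φ (gset X A) ^ Multiplicative.toAdd c) n =
      Perfection.mk (TateTowerTheta.thetaZerosPhi φ (gset X A)) 1 :=
    PfImageWeak.toRealification_injective hM.weak hb
  obtain ⟨N, hN⟩ := Perfection.mk_eq_mk_iff.mp h1
  rw [← pow_mul, PNat.one_coe, mul_one] at hN
  exact TateTowerTheta.thetaZerosPhi_pow_ne_diag_pow φ (gset X A) (Nat.mul_ne_zero N.ne_zero n.ne_zero) _ hN.symm

/-- In particular `Φ^{bs-fld} ⊊ Φ` over `X` itself (the one-point covering `Π^tp_X/Π^tp_X`), where every chain-only tempered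
Frobenioid of record has `Φ^{bs-fld} = Φ`. [cite: MochizukiEtTh2009, Def 3.6 p.77] -/
theorem exists_mem_Φ_not_mem_bsFld_top :
    ∃ x ∈ (temperedFrobenioid X φ R S).Φ.carrier (op ((OneCompTempered.equiv X).functor.obj CosetCat.top)),
      x ∉ (temperedFrobenioid X φ R S).bsFld.carrier (op ((OneCompTempered.equiv X).functor.obj CosetCat.top)) :=
  exists_mem_Φ_not_mem_bsFld X φ R S _

/-! ## The §4 bi-Kummer setting over the `Ÿ`-skeleton data -/

variable (NH : Subgroup (Field.absoluteGaloisGroup K) → (temperedFrobenioid X φ R S).category → ℕ+ → Prop)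
  (M : OpenNormalSubgroup X.Pi)

/-- **The §4 bi-Kummer setting over the `Ÿ`-skeleton data at the genuine connected base** (`A_⊙ := (Π^tp_X/M, 0)`).
[cite: MochizukiEtTh2009, Def 4.1 p.86] -/
def setting : BiKummerSetting X (RealifiedDivisorMonoids.ofRlfZWeak (dm X φ) (hpf X φ)) (ConnectedPart (BTemp X.Pi))
    (treeCatVocab (ConnectedPart (BTemp X.Pi)) R S) :=
  BiKummerSetting.mkOfConnectedTemperoid X (temperedFrobenioid X φ R S) rfl (hP X φ R S) NH
    ((temperedFrobenioid X φ R S).connQuotZeroObj M) ((temperedFrobenioid X φ R S).isFrobeniusTrivial_connQuotZeroObj M)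
    ((temperedFrobenioid X φ R S).isGaloisObj_connQuotZeroObj_base M)

/-- **Non-vacuity**: the `Ÿ`-skeleton tempered Frobenioid and its §4 setting exist for every `X`, `φ`, `R`, `S`, `NH`, `M`.
[cite: MochizukiEtTh2009, Def 4.1 p.86] -/
theorem nonempty_setting (NH : Subgroup (Field.absoluteGaloisGroup K) → (temperedFrobenioid X φ R S).category → ℕ+ → Prop)
    (M : OpenNormalSubgroup X.Pi) :
    Nonempty (BiKummerSetting X (RealifiedDivisorMonoids.ofRlfZWeak (dm X φ) (hpf X φ)) (ConnectedPart (BTemp X.Pi))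
      (treeCatVocab (ConnectedPart (BTemp X.Pi)) R S)) :=
  ⟨setting X φ R S NH M⟩

end ThetaTowerTempered

end Literature.AnabelianGeometry.EtaleTheta

end
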